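import Summits.BirchSwinnertonDyer.Rank1Residual.F1Sign2.NormDepthTopLevelAtTwo
import Mathlib.Algebra.Group.Nat.Even
import Mathlib.Data.Finset.Max
import Mathlib.Tactic.NormNum
import Mathlib.Tactic.Ring
import Mathlib.Tactic.Tauto
import Mathlib.Tactic.SplitIfs
import Mathlib.Tactic.ByContra
import HarnessLib

/-!
# The non-alternation locus in closed form, every cyclotomic layer — the combinatorial shadow of -imc's alternation law O-59alt
# (cell `bsd-f1-sign2`; -imc g19 `Sketch60.lean` 4f785febc4f92cf3 = MEMO-imc §10.99-add7 (c); REF2-PLACEMENT v54 §14 (PREDICTION #14), §22; typer -ty g19)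

PURE `ℕ`-ARITHMETIC: definitions with bodies and theorems PROVED in this file (`decide +kernel`, `omega`); no curve, no field, no conjecture, no named fact.
Third file of the norm-depth story, in the namespace and vocabulary of `NormDepthCombinatoricsAtTwo.lean` (p725951: `flagJumpSet e` = `J(e)` the jump set of the
formal-level `[2]`-Kummer flag, `normHitSet e f` = `H(f)` the Hazewinkel norm-hit set [cite: Hazewinkel1974NormMapsI, §2.4]) and `NormDepthTopLevelAtTwo.lean` (-ty g18:
`flagJumpSet_sup_layers`, `topLevelMissed_iff_layer1..6` = REF2's PREDICTION #14 layer by layer, `f* = 4, 9, 16, 33, 64, 129`).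
WHAT IS NEW (-imc g19, Sketch60): the closed form for EVERY layer `e = 2ⁿ`, `n ≥ 3` — `{f ∈ [2, 2e+1] : m*(e) ∉ H_e(f)} = {2e}` if `m*(e) = e + ⌊e/3⌋` is even,
`= {2e+1}` if it is odd (`nonAlternationLocus_closedForm`; witnesses `m' = 2m*+1−f` and `m' = m*÷2`, then `omega`) — and the parity law `m*(2ⁿ)` even ⟺ `n` odd
(`topJumpParity`); together: EXACTLY ONE non-alternating conductor exponent per layer, `f*(n) = 2e + [n even]`, which is REF2's PREDICTION #14 (v54 §14.3, pre-registered
14:35Z before -imc's add7; -imc pre-registered the same closed form 14:24Z and 14:42Z).  CREDIT (INBOX 16:25:24Z, -imc): #14 is REF2's; the membership-side confirmation on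
layers 3, 4, 5 (add7 (c): `{16}` 0 of 6 vs 6 of 6 elsewhere; `{33}` 0 of 10 uniformizer targets, all 15 unit levels incl. `f = 32` in `W`; `{64}` 0 of 6, 31 other levels and
7 of 7 uniformizers in `W`) and this Lean proof are -imc's.
VOCABULARY.  -imc's `flagJumpSetAtTwo` IS g18's `flagJumpSet` (`flagJumpSetAtTwo_eq_flagJumpSet`, every `e`); -imc's `normLevelSetAtTwo e f` truncates the witness range at
`m' ≤ 4e` where `normHitSet e f` truncates at `r < 3e`: `normHitSet e f ⊆ normLevelSetAtTwo e f`, and for `f ≥ 2` membership of the top jump is the same in both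
(`topJumpAtTwo_mem_normLevelSetAtTwo_iff`); `topJumpAtTwo e = (flagJumpSet e).sup id` at `e = 8, 16, 32, 64` (`topJumpAtTwo_eq_sup_layers`, from `flagJumpSet_sup_layers`);
hence g18's `topLevelMissed_iff_layer3..6` are the instances `n = 3, …, 6` of `nonAlternationLocus_closedForm` (`mem_nonAlternationLocusAtTwo_iff_topLevelMissed`).  Everything
between the namespace line and the marker `TYPER BRIDGES` is Sketch60 VERBATIM (namespace `Sketch60` ↦ `NormDepthAtTwo`; `import Mathlib` ↦ minimal imports; docstrings marked
«docstring: typer» added where the sketch had none; three riders marked «RIDER, typer»); the bridge theorems after the marker are the typer's (proved, `omega`, `decide`).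
STATUS AND RIDERS (REF2 v54 §9.3, §14, §22.1, §22.3 «type the closed form, top-jump parity PLAIN (kernel-decided)»; -imc 16:25:24Z «Sketch60 is PLAIN arithmetic (no curve
input) — port as is»).  WHAT THIS FILE DOES NOT SAY: (i) the ARITHMETIC criterion «`Q_δ` NOT alternating ⟺ `c ∉ W_δ` ⟺ `m*(e) ∉ H_e(f)`» (-imc O-59alt = REF2 #12 + #13 + O-59γ +
-es T3 Cor.) is the cell's identification, NOT IN PRINT — frame in print (v54 §9.3): the quadratic refinement of the local Tate pairing on `H¹(K_v, E[2])` with the Kummer image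
maximal isotropic [cite: PoonenRains2012, §4.1, Prop. 4.10] and the twist-invariance #12 from Mumford's theta group; the vanishing pattern of the alternation defect along the
height-2 tower is not printed; (ii) O-59γ «`loc(γ_E γ_E′)` spans the top-jump formal piece `κ(Ê(𝔭^(m*)))`, `m* = e + ⌊e/3⌋`» (v54 §14.2, §22.1: identification not in print,
THEOREM-CANDIDATE by pure local Kummer theory; print part = the jump set of the formal-group filtration under `[2]`, Hazewinkel's norm-hit set, and Yelton's `δ`-free element
[cite: Yelton2015, Prop. 2.8, Thm. 3.1]) is WORDS-ONLY — the tree has no carrier for `κ(Ê(𝔭^m)) ⊂ H¹` yet (-imc 16:25:24Z), so it is NOT typed here; (iii) the Gram side of #14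
(is `Q_δ` non-alternating exactly at `f*`?) is -imc's ENGINE test (layer 3 ✓ add6 (c); layer 4 pending at port time, jobs j332349–51, j333219–27).
PARTITION none; beyond-print theorem: no (pure arithmetic); nothing here bears on BSD; 23715 not closed.  bears_on: stmt-BirchSwinnertonDyer-23715 (via
`TowerKummerAtlasAtTwo.lean`, words P59 and O-59).
-/

namespace Summit.BirchSwinnertonDyer.Rank1Residual.F1Sign2.NormDepthAtTwo

/-- Hazewinkel norm-level set `H_e(f)` (levels `m` such that `U^{(m)}` meets the norm group from conductor `f` with a jump),
with `m'` ranging over `[1, 4e]` (enough for `f ≤ 2e+1`). -/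
def normLevelSetAtTwo (e f : ℕ) : Finset ℕ :=
  ((Finset.Icc 1 (4 * e)).filter (fun m' => 2 * m' ≠ (m' + f) / 2)).image (fun m' => min (2 * m') ((m' + f) / 2))

/-- The formal-flag jump set `J_e = { j ∈ [1, 2e) : 4 ∤ j ∧ 3j < 4e }`. -/
def flagJumpSetAtTwo (e : ℕ) : Finset ℕ :=
  (Finset.Ico 1 (2 * e)).filter (fun j => ¬ 4 ∣ j ∧ 3 * j < 4 * e)

/-- The top jump `m*(e) = e + ⌊e/3⌋`. -/
def topJumpAtTwo (e : ℕ) : ℕ := e + e / 3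

/-- The predicted non-alternation locus among conductor exponents `f ∈ [2, 2e+1]`. -/
def nonAlternationLocusAtTwo (e : ℕ) : Finset ℕ :=
  (Finset.Icc 2 (2 * e + 1)).filter (fun f => topJumpAtTwo e ∉ normLevelSetAtTwo e f)

/-- `m*(e)` is the maximum of the jump set (layers 3, 4, 5, 6). -/
theorem topJump_eq_max_layer3 : (flagJumpSetAtTwo 8).max = some (topJumpAtTwo 8) := by decide +kernel
/-- (layer 4: `e = 16`, `m* = 21`; docstring: typer.) -/
theorem topJump_eq_max_layer4 : (flagJumpSetAtTwo 16).max = some (topJumpAtTwo 16) := by decide +kernel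

/-- CLOSED FORM, layer 3 (`e = 8`, `m* = 10` even): the defect sits at the top unit conductor `2e = 16`. -/
theorem nonAlternationLocus_layer3 : nonAlternationLocusAtTwo 8 = {16} := by decide +kernel
/-- CLOSED FORM, layer 4 (`e = 16`, `m* = 21` odd): the defect sits at the uniformizer conductor `2e+1 = 33`. -/
theorem nonAlternationLocus_layer4 : nonAlternationLocusAtTwo 16 = {33} := by decide +kernel
/-- CLOSED FORM, layer 5 (`e = 32`, `m* = 42` even): `2e = 64`. -/
theorem nonAlternationLocus_layer5 : nonAlternationLocusAtTwo 32 = {64} := by decide +kernel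

/-- O-59alt (support, general form; proof = the two-case analysis of MEMO §10.99-add7 (c)):
for every `e = 2^n`, `n ≥ 3`, the locus is `{2e}` when `m*(e)` is even and `{2e+1}` when it is odd.
(RIDER, typer -ty g19: PLAIN — a THEOREM of this file (`nonAlternationLocus_closedForm`), not a conjecture; together with `TopJumpParityAtTwo` it is the MODEL side of
REF2's PREDICTION #14 «exactly one non-alternating conductor exponent per layer, `f*(n) = 2e + [n even]`» (v54 §14.3, pre-registered before -imc's add7; credit per INBOX
16:25:24Z: #14 is REF2's, the membership-side confirmation on layers 3/4/5 and this proof are -imc's).  The ARITHMETIC reading — -imc's O-59alt «`Q_δ` NOT alternating ⟺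
`c ∉ W_δ` ⟺ `m*(e) ∉ H_e(f)`» = REF2 #12 + #13 + O-59γ + -es T3 Cor. — is the cell's identification, NOT IN PRINT (v54 §9.3, §14.2, §22.1) and is NOT asserted by this `Prop`;
g18's `topLevelMissed_iff_layer1..6` (`NormDepthTopLevelAtTwo.lean`) are its instances `e = 2, …, 64` in the `normHitSet` vocabulary, see the typer bridges at the end of
this file.) -/
def NonAlternationLocusClosedFormAtTwo : Prop :=
  ∀ n : ℕ, 3 ≤ n → nonAlternationLocusAtTwo (2 ^ n) = if Even (topJumpAtTwo (2 ^ n)) then {2 * 2 ^ n} else {2 * 2 ^ n + 1}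

/-- Parity of `m*(2^n)` alternates with `n`: even for odd `n ≥ 3`, odd for even `n ≥ 4` (since `⌊2^n/3⌋` has the parity of `n+1`).
(RIDER, typer: PLAIN, proved below (`topJumpParity`) = the parity-mechanism line of REF2 v54 §14.3 «`max J = e + ⌊e/3⌋` is odd iff `n` is even: `⌊2ⁿ/3⌋ = (2ⁿ−1)/3` odd
for `n` even, `(2ⁿ−2)/3` even for `n` odd»; `m*(e) = max J(e)` at `e = 8, …, 64`: `topJump_eq_max_layer3/4`, `topJumpAtTwo_eq_sup_layers`.) -/
def TopJumpParityAtTwo : Prop := ∀ n : ℕ, 3 ≤ n → (Even (topJumpAtTwo (2 ^ n)) ↔ Odd n)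

/-- Parity of `m*(e)` at `e = 8, 16, 32, 64` by `decide`: even, odd, even, odd (docstring: typer). -/
theorem topJumpParity_small : (Even (topJumpAtTwo 8) ∧ ¬ Even (topJumpAtTwo 16) ∧ Even (topJumpAtTwo 32) ∧ ¬ Even (topJumpAtTwo 64)) := by decide

/-- `2^n mod 3` is `1` for even `n` and `2` for odd `n`.
(RIDER, typer: the gate notes the same statement as `Summit.ABC.ABC.Theorems.two_pow_mod_three` (`SoloBlindOmega3Corners.lean`) in another summit tree — not importable
across summits, re-proved here in two lines.) -/
theorem two_pow_mod_three (n : ℕ) : 2 ^ n % 3 = if Even n then 1 else 2 := by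
  rcases Nat.even_or_odd n with ⟨k, rfl⟩ | ⟨k, rfl⟩
  · have : (2 : ℕ) ^ (k + k) = 4 ^ k := by rw [← two_mul, pow_mul]; norm_num
    rw [this, Nat.pow_mod]; norm_num
  · have h4 : (2 : ℕ) ^ (2 * k + 1) = 2 * 4 ^ k := by rw [pow_succ, pow_mul]; norm_num; ring
    have hk : ¬ Even (2 * k + 1) := Nat.not_even_iff_odd.mpr ⟨k, rfl⟩
    rw [h4, if_neg hk, Nat.mul_mod, Nat.pow_mod]; norm_num

/-- PROVED in general: the parity of the top jump `m*(2^n) = 2^n + ⌊2^n/3⌋` is the parity of `n + 1`. -/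
theorem topJumpParity : TopJumpParityAtTwo := by
  intro n hn
  have hdm := Nat.div_add_mod (2 ^ n) 3
  have h3 := two_pow_mod_three n
  have h2 : 2 ∣ 2 ^ n := dvd_pow_self 2 (by omega)
  obtain ⟨s, hs⟩ := h2
  unfold topJumpAtTwo
  rw [Nat.even_iff]
  rcases Nat.even_or_odd n with hev | hod
  · rw [if_pos hev] at h3
    have hno : ¬ Odd n := Nat.not_odd_iff_even.mpr hev
    simp only [hno, iff_false]
    omega
  · rw [if_neg (Nat.not_even_iff_odd.mpr hod)] at h3
    simp only [hod, iff_true]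
    omega

/-- Membership unfolding of `normLevelSetAtTwo` (docstring: typer). -/
theorem mem_normLevelSetAtTwo {e f m : ℕ} :
    m ∈ normLevelSetAtTwo e f ↔ ∃ a, 1 ≤ a ∧ a ≤ 4 * e ∧ 2 * a ≠ (a + f) / 2 ∧ min (2 * a) ((a + f) / 2) = m := by
  unfold normLevelSetAtTwo
  simp only [Finset.mem_image, Finset.mem_filter, Finset.mem_Icc]
  constructor
  · rintro ⟨a, ha⟩
    exact ⟨a, by tauto⟩
  · rintro ⟨a, ha⟩
    exact ⟨a, by tauto⟩

/-- Membership unfolding of `nonAlternationLocusAtTwo` (docstring: typer). -/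
theorem mem_nonAlternationLocusAtTwo {e f : ℕ} :
    f ∈ nonAlternationLocusAtTwo e ↔ (2 ≤ f ∧ f ≤ 2 * e + 1) ∧ topJumpAtTwo e ∉ normLevelSetAtTwo e f := by
  unfold nonAlternationLocusAtTwo
  simp only [Finset.mem_filter, Finset.mem_Icc]

/-- PROVED in general (O-59alt's combinatorial shadow is a THEOREM): for every layer `e = 2^n`, `n ≥ 3`, the locus
`{f ∈ [2, 2e+1] : m*(e) ∉ H_e(f)}` is `{2e}` if `m*(e)` is even (⟺ `n` odd, `topJumpParity`) and `{2e+1}` otherwise;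
witnesses `m' = 2m*+1-f` (generic) and `m' = m*/2` (uniformizer conductor, `m*` even); `omega` does the rest.
(RIDER, typer: layers 1–2 (`e = 2, 4`) lie outside `3 ≤ n` but fit the same formula — g18 `topLevelMissed_iff_layer1/2`: `f* = 4 = 2e` (`m* = 2` even), `f* = 9 = 2e+1`
(`m* = 5` odd); for non-2-power `e` two exponents can fail (REF2 v54 §14.3: `e = 6 ↦ {12, 13}`), irrelevant to the cyclotomic tower.) -/
theorem nonAlternationLocus_closedForm : NonAlternationLocusClosedFormAtTwo := by
  intro n hn
  have hmod := two_pow_mod_three n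
  have h8 : 8 ≤ 2 ^ n := by
    calc (8 : ℕ) = 2 ^ 3 := by norm_num
      _ ≤ 2 ^ n := Nat.pow_le_pow_right (by norm_num) hn
  generalize he : 2 ^ n = e at *
  have hd := Nat.div_add_mod e 3
  have hr : e % 3 = 1 ∨ e % 3 = 2 := by split_ifs at hmod <;> omega
  have hpar : Even (topJumpAtTwo e) ↔ e % 3 = 2 := by
    unfold topJumpAtTwo
    rw [Nat.even_iff]
    constructor <;> intro h <;> omega
  ext f
  rw [mem_nonAlternationLocusAtTwo, mem_normLevelSetAtTwo]
  unfold topJumpAtTwo at hpar ⊢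
  split_ifs with hev
  · rw [hpar] at hev
    rw [Finset.mem_singleton]
    constructor
    · rintro ⟨⟨hf1, hf2⟩, hno⟩
      by_contra hne
      apply hno
      by_cases htop : f = 2 * e + 1
      · exact ⟨(e + e / 3) / 2, by omega, by omega, by omega, by omega⟩
      · exact ⟨2 * (e + e / 3) + 1 - f, by omega, by omega, by omega, by omega⟩
    · rintro rfl
      refine ⟨⟨by omega, by omega⟩, ?_⟩
      rintro ⟨a, h1, h2, h3, h4⟩
      omega
  · rw [hpar] at hev
    rw [Finset.mem_singleton]
    constructor
    · rintro ⟨⟨hf1, hf2⟩, hno⟩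
      by_contra hne
      apply hno
      exact ⟨2 * (e + e / 3) + 1 - f, by omega, by omega, by omega, by omega⟩
    · rintro rfl
      refine ⟨⟨by omega, by omega⟩, ?_⟩
      rintro ⟨a, h1, h2, h3, h4⟩
      omega

/-! ## TYPER BRIDGES (typer -ty g19; not part of Sketch60) — -imc's vocabulary against g18's `flagJumpSet` / `normHitSet` (`NormDepthCombinatoricsAtTwo.lean`,
`NormDepthTopLevelAtTwo.lean`); all proved (`tauto`, `omega`, `decide`). -/

/-- -imc's `flagJumpSetAtTwo` is g18's `flagJumpSet`, for every `e` (typer bridge). -/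
theorem flagJumpSetAtTwo_eq_flagJumpSet (e : ℕ) : flagJumpSetAtTwo e = flagJumpSet e := by
  ext j
  simp only [flagJumpSetAtTwo, flagJumpSet, Finset.mem_filter, Finset.mem_Ico, Finset.mem_range]
  tauto

/-- g18's `normHitSet e f` (witnesses `r < 3e`) lies in -imc's `normLevelSetAtTwo e f` (witnesses `m' ≤ 4e`); both truncate the same infinite hit set (typer bridge). -/
theorem normHitSet_subset_normLevelSetAtTwo (e f : ℕ) : normHitSet e f ⊆ normLevelSetAtTwo e f := by
  intro m hm
  simp only [normHitSet, Finset.mem_image, Finset.mem_filter, Finset.mem_range] at hm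
  obtain ⟨r, ⟨hr, h1, h2⟩, rfl⟩ := hm
  exact mem_normLevelSetAtTwo.mpr ⟨r, h1, by omega, h2, rfl⟩

/-- For conductor exponents `f ≥ 2` the top jump `m*(e) = e + ⌊e/3⌋` is hit in -imc's `normLevelSetAtTwo e f` iff it is hit in g18's `normHitSet e f`
(a witness `m' ≥ 3e` gives `2m' ≥ 6e` and `⌊(m'+f)/2⌋ ≥ ⌊3e/2⌋ + 1`, both above `m*(e)`) (typer bridge). -/
theorem topJumpAtTwo_mem_normLevelSetAtTwo_iff (e f : ℕ) (hf : 2 ≤ f) :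
    topJumpAtTwo e ∈ normLevelSetAtTwo e f ↔ topJumpAtTwo e ∈ normHitSet e f := by
  refine ⟨fun h => ?_, fun h => normHitSet_subset_normLevelSetAtTwo e f h⟩
  obtain ⟨a, h1, -, h3, h4⟩ := mem_normLevelSetAtTwo.mp h
  simp only [normHitSet, Finset.mem_image, Finset.mem_filter, Finset.mem_range]
  refine ⟨a, ⟨?_, h1, h3⟩, h4⟩
  unfold topJumpAtTwo at h4
  omega

/-- `m*(e) = topJumpAtTwo e` is the top flag level `(flagJumpSet e).sup id` at `e = 8, 16, 32, 64` (`10, 21, 42, 85`; from g18's `flagJumpSet_sup_layers`) (typer bridge). -/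
theorem topJumpAtTwo_eq_sup_layers :
    topJumpAtTwo 8 = (flagJumpSet 8).sup id ∧ topJumpAtTwo 16 = (flagJumpSet 16).sup id ∧
      topJumpAtTwo 32 = (flagJumpSet 32).sup id ∧ topJumpAtTwo 64 = (flagJumpSet 64).sup id := by
  obtain ⟨-, -, h8, h16, h32, h64⟩ := flagJumpSet_sup_layers
  rw [h8, h16, h32, h64]
  decide

/-- In the range `2 ≤ f ≤ 2e+1`, membership in -imc's `nonAlternationLocusAtTwo e` is g18's «top level missed by `normHitSet e f`»; with `topJumpAtTwo_eq_sup_layers`,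
g18's `topLevelMissed_iff_layer3..6` are the instances `e = 8, 16, 32, 64` of `nonAlternationLocus_closedForm` (typer bridge). -/
theorem mem_nonAlternationLocusAtTwo_iff_topLevelMissed {e f : ℕ} (hf : f ∈ Finset.Icc 2 (2 * e + 1)) :
    f ∈ nonAlternationLocusAtTwo e ↔ topJumpAtTwo e ∉ normHitSet e f := by
  rw [Finset.mem_Icc] at hf
  rw [mem_nonAlternationLocusAtTwo, topJumpAtTwo_mem_normLevelSetAtTwo_iff e f hf.1]
  exact ⟨fun h => h.2, fun h => ⟨hf, h⟩⟩

end Summit.BirchSwinnertonDyer.Rank1Residual.F1Sign2.NormDepthAtTwo
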